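import Summits.ValiantsHypothesis.ValiantsHypothesis.Theorems.LacunarySymmetroidMatrixDescartesPivotResolventRolle

/-!
# `MatrixDescartes` census — the SLOPE of the resolvent profile `R(x)/x^e` and the MIDDLE-RANGE LAW
# (`(R/x^e)′ = (R·τ_e + π_e)/(S·x^{e+1})`: the profile is monotone wherever the tilts `τ_e`, `π_e` have the same sign)

HONEST FRAMING.  Object-search cell `pub-symmetroid`, seat `val-sym-mdr-p1` (generation 18); helper file `--supports` the crux item
stmt-ValiantsHypothesis-18050 (`Theses.LacunarySymmetroid.MatrixDescartes`, OPEN, on HOLD) with NO closure claim.  Companion of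
`…PivotResolventRolle` (p633347): there, the positive roots of a `2 × 2` pivot-pencil determinant `f(x) = −δx^{2e} + x^e τ(x) + π(x)` (`δ > 0`,
`π ≥ 0`) are the solutions of `R(x) = x^e`, `R = (τ + S)/(2δ)`, `S = √(τ² + 4δπ)`, and `Z₊(f) ≤ 1 + #`critical points of the profile `R/x^e`.
HERE the derivative of the profile is computed in closed form (`hasDerivAt_resolventProfile`):
**`(R/x^e)′(x) = (R(x)·τ_e(x) + π_e(x)) / (S(x)·x^{e+1})`**, `τ_e = xτ′ − eτ`, `π_e = xπ′ − 2eπ` (the e-TILTS of `τ` and `π`).  Consequently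
(`resolventProfile_strictAntiOn` / `_strictMonoOn`): on any interval of `(0, ∞)` where `τ_e ≤ 0` and `π_e < 0` the profile is strictly
decreasing, where `τ_e ≥ 0` and `π_e > 0` strictly increasing — the **MIDDLE-RANGE LAW**.  For the rank-one four-letter pencil in hyperbolic
normal form (`τ = −2U`, `π = Π = ∑_{k<l} π_{kl} x^{dₖ+d_l}`): `τ_e = −2U_e` and `π_e = Π_e = ∑ (dₖ + d_l − 2e) π_{kl} x^{dₖ+d_l}` each have ONE
sign change on the `1|3` split in chamber (C) (`d₀ + d₁ < 2e < d₀ + d₂`), with zeros `x_U`, `x_Π`; between them the profile is monotone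
(decreasing if `x_U < x_Π`, increasing if `x_Π < x_U`), so all its turning points lie in `(0, min(x_U, x_Π)) ∪ (max(x_U, x_Π), ∞)` (located:
at most `2 + 3`; the count itself stays OPEN).  Nothing here bears on `MatrixDescartes` in its window, on `DoorA26` / `DoorA34`, registers /
credences, or `VP ≠ VNP`.

[folklore] Chain rule; monotonicity from the sign of the derivative (Mathlib `strictAntiOn_of_deriv_neg` / `strictMonoOn_of_deriv_pos`).
No definitions, no named facts.
-/

-- `Summit.ValiantsHypothesis.ValiantsHypothesis.…` repeats a component by the D-0017 layout
-- (single-conjunct summit), which the `dupNamespace` linter flags; the name is mandated.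
set_option linter.dupNamespace false

namespace Summit.ValiantsHypothesis.ValiantsHypothesis.Theorems.LacunarySymmetroidMatrixDescartes.Pivot.Resolvent

open Polynomial Set
open scoped BigOperators

/-- Quotient rule for `y ↦ R(y)/y^e` at `x ≠ 0`: derivative `(x·R′(x) − e·R(x))/x^{e+1}`. [folklore] -/
theorem hasDerivAt_div_pow (R : ℝ → ℝ) (R' x : ℝ) (e : ℕ) (hx : x ≠ 0) (hR : HasDerivAt R R' x) :
    HasDerivAt (fun y => R y / y ^ e) ((x * R' - e * R x) / x ^ (e + 1)) x := by
  have hxe : x ^ e ≠ 0 := pow_ne_zero e hx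
  have h := hR.div (hasDerivAt_pow e x) hxe
  refine h.congr_deriv ?_
  rcases Nat.eq_zero_or_pos e with he | he
  · subst he
    field_simp
    ring
  · obtain ⟨n, rfl⟩ : ∃ n, e = n + 1 := ⟨e - 1, by omega⟩
    rw [Nat.add_sub_cancel]
    field_simp
    ring

/-- **SLOPE OF THE RESOLVENT PROFILE.**  For `δ > 0`, polynomials `τ, π`, `e : ℕ` and `x > 0` with positive discriminant
`S(x)² = τ(x)² + 4δπ(x) > 0`, the profile `y ↦ R(y)/y^e`, `R = (τ + S)/(2δ)`, has derivative
`(R(x)·τ_e(x) + π_e(x)) / (S(x)·x^{e+1})` at `x`, where `τ_e = xτ′ − eτ`, `π_e = xπ′ − 2eπ`.  [this file: `S·xS′ = τ·xτ′ + 2δ·xπ′`, so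
`2δS(xR′ − eR) = (τ + S)τ_e + 2δπ_e − e(S² − τ² − 4δπ)`.] -/
theorem hasDerivAt_resolventProfile (δ : ℝ) (e : ℕ) (τ π : ℝ[X]) (x : ℝ) (hδ : 0 < δ) (hx : 0 < x)
    (hdisc : 0 < (τ.eval x) ^ 2 + 4 * δ * π.eval x) :
    HasDerivAt (fun y => ((τ.eval y + Real.sqrt ((τ.eval y) ^ 2 + 4 * δ * π.eval y)) / (2 * δ)) / y ^ e)
      ((((τ.eval x + Real.sqrt ((τ.eval x) ^ 2 + 4 * δ * π.eval x)) / (2 * δ)) * (x * τ.derivative.eval x - e * τ.eval x)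
          + (x * π.derivative.eval x - 2 * e * π.eval x))
        / (Real.sqrt ((τ.eval x) ^ 2 + 4 * δ * π.eval x) * x ^ (e + 1))) x := by
  have hR := hasDerivAt_resolvent δ τ π x hdisc
  have h := hasDerivAt_div_pow _ _ x e hx.ne' hR
  refine h.congr_deriv ?_
  set S := Real.sqrt ((τ.eval x) ^ 2 + 4 * δ * π.eval x) with hSdef
  have hSpos : 0 < S := Real.sqrt_pos.2 hdisc
  have hS2 : S ^ 2 = (τ.eval x) ^ 2 + 4 * δ * π.eval x := Real.sq_sqrt hdisc.le
  set t := τ.eval x; set t' := τ.derivative.eval x; set p := π.eval x; set p' := π.derivative.eval x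
  have hδ0 : δ ≠ 0 := hδ.ne'
  have hS0 : S ≠ 0 := hSpos.ne'
  have hx0 : x ^ (e + 1) ≠ 0 := pow_ne_zero _ hx.ne'
  rw [div_eq_div_iff hx0 (mul_ne_zero hS0 hx0)]
  have key : (x * ((t' + (2 * t * t' + 4 * δ * p') / (2 * S)) / (2 * δ)) - e * ((t + S) / (2 * δ))) * S
      = (t + S) / (2 * δ) * (x * t' - e * t) + (x * p' - 2 * e * p) := by
    field_simp
    linear_combination (-2 * (e : ℝ)) * hS2
  calc (x * ((t' + (2 * t * t' + 4 * δ * p') / (2 * S)) / (2 * δ)) - e * ((t + S) / (2 * δ))) * (S * x ^ (e + 1))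
      = ((x * ((t' + (2 * t * t' + 4 * δ * p') / (2 * S)) / (2 * δ)) - e * ((t + S) / (2 * δ))) * S) * x ^ (e + 1) := by ring
    _ = ((t + S) / (2 * δ) * (x * t' - e * t) + (x * p' - 2 * e * p)) * x ^ (e + 1) := by rw [key]

/-- **Sign of the slope.**  Under the same hypotheses, with `R(x) ≥ 0` (automatic when `π(x) ≥ 0`): if `τ_e(x) ≤ 0` and `π_e(x) < 0` then
the profile's derivative at `x` is negative; if `τ_e(x) ≥ 0` and `π_e(x) > 0` it is positive. [this file] -/
theorem deriv_resolventProfile_sign (δ : ℝ) (e : ℕ) (τ π : ℝ[X]) (x : ℝ) (hδ : 0 < δ) (hx : 0 < x) (hπ : 0 ≤ π.eval x)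
    (hdisc : 0 < (τ.eval x) ^ 2 + 4 * δ * π.eval x) :
    ((x * τ.derivative.eval x - e * τ.eval x ≤ 0) → (x * π.derivative.eval x - 2 * e * π.eval x < 0) →
      deriv (fun y => ((τ.eval y + Real.sqrt ((τ.eval y) ^ 2 + 4 * δ * π.eval y)) / (2 * δ)) / y ^ e) x < 0)
    ∧ ((0 ≤ x * τ.derivative.eval x - e * τ.eval x) → (0 < x * π.derivative.eval x - 2 * e * π.eval x) →
      0 < deriv (fun y => ((τ.eval y + Real.sqrt ((τ.eval y) ^ 2 + 4 * δ * π.eval y)) / (2 * δ)) / y ^ e) x) := by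
  have hD := hasDerivAt_resolventProfile δ e τ π x hδ hx hdisc
  rw [hD.deriv]
  have hR : 0 ≤ (τ.eval x + Real.sqrt ((τ.eval x) ^ 2 + 4 * δ * π.eval x)) / (2 * δ) := resolventRoot_nonneg δ _ _ hδ hπ
  have hden : 0 < Real.sqrt ((τ.eval x) ^ 2 + 4 * δ * π.eval x) * x ^ (e + 1) := mul_pos (Real.sqrt_pos.2 hdisc) (pow_pos hx _)
  refine ⟨fun hτe hπe => div_neg_of_neg_of_pos ?_ hden, fun hτe hπe => div_pos ?_ hden⟩
  · nlinarith [mul_nonpos_of_nonneg_of_nonpos hR hτe]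
  · nlinarith [mul_nonneg hR hτe]

/-- **MIDDLE-RANGE LAW (decreasing side).**  On an interval `I ⊆ (0, ∞)` on which `π ≥ 0`, the discriminant is positive, `τ_e ≤ 0` and
`π_e < 0`, the resolvent profile `R/x^e` is strictly decreasing — so it has no turning point there and `R(x) = x^e` has at most one solution in
`I`.  (Rank-one four-letter pencil, hyperbolic normal form, chamber (C): `I = (x_U, x_Π)` when the zero `x_U` of `U_e` precedes the zero `x_Π`
of `Π_e`.) [this file + Mathlib `strictAntiOn_of_deriv_neg`] -/
theorem resolventProfile_strictAntiOn (δ : ℝ) (e : ℕ) (τ π : ℝ[X]) (hδ : 0 < δ) (a b : ℝ) (ha : 0 < a)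
    (hπ : ∀ x ∈ Icc a b, 0 ≤ π.eval x) (hdisc : ∀ x ∈ Icc a b, 0 < (τ.eval x) ^ 2 + 4 * δ * π.eval x)
    (hτe : ∀ x ∈ Ioo a b, x * τ.derivative.eval x - e * τ.eval x ≤ 0)
    (hπe : ∀ x ∈ Ioo a b, x * π.derivative.eval x - 2 * e * π.eval x < 0) :
    StrictAntiOn (fun y => ((τ.eval y + Real.sqrt ((τ.eval y) ^ 2 + 4 * δ * π.eval y)) / (2 * δ)) / y ^ e) (Icc a b) := by
  apply strictAntiOn_of_deriv_neg (convex_Icc a b)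
  · intro x hx
    exact (hasDerivAt_resolventProfile δ e τ π x hδ (lt_of_lt_of_le ha hx.1) (hdisc x hx)).continuousAt.continuousWithinAt
  · intro x hx
    rw [interior_Icc] at hx
    have hx0 : 0 < x := ha.trans hx.1
    exact (deriv_resolventProfile_sign δ e τ π x hδ hx0 (hπ x (Ioo_subset_Icc_self hx)) (hdisc x (Ioo_subset_Icc_self hx))).1
      (hτe x hx) (hπe x hx)

/-- **MIDDLE-RANGE LAW (increasing side).**  On an interval `I ⊆ (0, ∞)` on which `π ≥ 0`, the discriminant is positive, `τ_e ≥ 0` and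
`π_e > 0`, the resolvent profile is strictly increasing. [this file + Mathlib `strictMonoOn_of_deriv_pos`] -/
theorem resolventProfile_strictMonoOn (δ : ℝ) (e : ℕ) (τ π : ℝ[X]) (hδ : 0 < δ) (a b : ℝ) (ha : 0 < a)
    (hπ : ∀ x ∈ Icc a b, 0 ≤ π.eval x) (hdisc : ∀ x ∈ Icc a b, 0 < (τ.eval x) ^ 2 + 4 * δ * π.eval x)
    (hτe : ∀ x ∈ Ioo a b, 0 ≤ x * τ.derivative.eval x - e * τ.eval x)
    (hπe : ∀ x ∈ Ioo a b, 0 < x * π.derivative.eval x - 2 * e * π.eval x) :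
    StrictMonoOn (fun y => ((τ.eval y + Real.sqrt ((τ.eval y) ^ 2 + 4 * δ * π.eval y)) / (2 * δ)) / y ^ e) (Icc a b) := by
  apply strictMonoOn_of_deriv_pos (convex_Icc a b)
  · intro x hx
    exact (hasDerivAt_resolventProfile δ e τ π x hδ (lt_of_lt_of_le ha hx.1) (hdisc x hx)).continuousAt.continuousWithinAt
  · intro x hx
    rw [interior_Icc] at hx
    have hx0 : 0 < x := ha.trans hx.1
    exact (deriv_resolventProfile_sign δ e τ π x hδ hx0 (hπ x (Ioo_subset_Icc_self hx)) (hdisc x (Ioo_subset_Icc_self hx))).2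
      (hτe x hx) (hπe x hx)

end Summit.ValiantsHypothesis.ValiantsHypothesis.Theorems.LacunarySymmetroidMatrixDescartes.Pivot.Resolvent
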